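import Literature.Computability.Cryptography.RegevSamplerStageCircuit
import Literature.Computability.QuantumComplexity.SandwichCircuit
import Literature.Computability.QuantumComplexity.CircuitEmbedding
import HarnessLib

/-!
# Regev 2009, Lemma 3.14 in machine form: the wires touched by the stage circuit

Topic `Computability/Cryptography` (family `pqc`), grouping namespace `Regev2009.SamplerClassical`; sequel of
`RegevSamplerStageCircuit.lean` (`stageCirc hΛ hF E T = C_Y ++ C_S ++ T@E ++ C_X ++ T@E`) on top of
`QuantumComplexity/CleanXorGadget.lean` (`CleanXor.ops`, `CleanXor.circuit`), `CleanComputePlaced.lean`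
(`CleanPlaced.mem_wires_placedOps`) and `SandwichCircuit.lean` (`exists_mem_wiresOf_of_mem_revCompile_toRevList`).

A purely SYNTACTIC fact needed by the idle-wire analysis of the universal circuit of Regev's one-copy sampler
(J. ACM 56 (2009), art. 34, Lemma 3.14): every gate of the stage circuit of a slot acts on the slot's own
wires — its zone wires `Λ.fin i` (`i < Λ.T`), its work window `[Λ.base, top)`, and the wires of the placed
subroutine `Set.range E`. Hence the stage circuits of the INACTIVE slots are "gates inside the idle set"
(`IdleGatesInvariance.bornPMF_gates_map_eq`, `StageBlockWires.stage_dichotomy`), and the active one is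
supported on its slot (`LightCone.supportedOn_toMatrix_circuit`).

* `CleanXor.mem_wires_ops`, `CleanXor.mem_wires_circuit` — wires of the garbage-free XOR oracle: data wires,
  work window, targets;
* `mem_wires_circY` / `mem_wires_circS` / `mem_wires_circX` — for the three compiled blocks of the stage;
* **`mem_wires_stageCirc`**, **`wires_stageCirc_subset`** — for the whole stage circuit.

Everything is proved; no definition, no named fact is introduced.

## References

* O. Regev, *On lattices, learning with errors, random linear codes, and cryptography*, J. ACM 56 (2009),
  art. 34, Lemma 3.14 (proof: the registers of the machine) [Regev2009].
* M. A. Nielsen, I. L. Chuang, *Quantum Computation and Quantum Information*, CUP 2010, §3.2.5, §4.2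
  [NielsenChuang2010].
-/

noncomputable section

namespace Literature.Computability.QuantumComplexity

namespace CleanXor

open Turing RevSim RevClean Cryptography ClassicalWrap CleanPlaced

variable {N : ℕ} {hN : 0 < N} {e : ℕ} {M : TM2ComputableAux Bool Bool} {n₀ : ℕ} {v : List Bool}
  {dpos : ℕ → ℕ} {base : ℕ} {m : ℕ} {tpos : ℕ → ℕ}

/-- **Wires of the garbage-free XOR oracle program**: data wires, work-window wires, or targets.
[cite: NielsenChuang2010, §3.2.5] -/
theorem mem_wires_ops (G : GeomOK N e M n₀ v dpos base m tpos) {op : ClOp (Fin N)}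
    (hop : op ∈ ops hN e M n₀ v dpos base m tpos) {x : Fin N} (hx : x ∈ wiresOf op) :
    (∃ i, i < n₀ ∧ (x : ℕ) = dpos i) ∨ (base ≤ (x : ℕ) ∧ (x : ℕ) < top e M n₀ v base) ∨
      (∃ j, j < m ∧ (x : ℕ) = tpos j) := by
  unfold ops at hop
  rcases List.mem_append.1 hop with hop | hop
  · exact (mem_wires_placedOps G.toGeomOK hop hx).elim Or.inl fun h => Or.inr (Or.inl h)
  rcases List.mem_append.1 hop with hop | hop
  · unfold xorOps at hop
    obtain ⟨a, ha, s, hs, rfl⟩ := mem_xorLayer.1 hop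
    have ha' := List.mem_range.1 ha
    rw [mem_wiresOf] at hx
    rcases hx with hx | hx
    · refine Or.inr (Or.inr ⟨a, ha', ?_⟩)
      rw [hx]
      exact val_tgt G ha'
    · simp only [ClOp.controls, List.mem_singleton] at hx
      subst hx
      unfold srcs at hs
      obtain ⟨a', -, rfl⟩ := List.mem_map.1 hs
      have hw := srcs_window G ha' a'
      refine Or.inr (Or.inl ?_)
      rw [val_finOf_of_lt hN (hw.2.trans_le G.top_le)]
      exact ⟨Nat.le_add_right _ _, hw.2⟩
  · exact (mem_wires_placedOps G.toGeomOK (List.mem_reverse.1 hop) hx).elim Or.inl fun h => Or.inr (Or.inl h)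

/-- **Wires of the compiled garbage-free XOR oracle.** [cite: NielsenChuang2010, §3.2.5] -/
theorem mem_wires_circuit (G : GeomOK N e M n₀ v dpos base m tpos) {g : QGate cliffordT N}
    (hg : g ∈ (circuit (hN := hN) G).gates) {x : Fin N} (hx : x ∈ g.wires) :
    (∃ i, i < n₀ ∧ (x : ℕ) = dpos i) ∨ (base ≤ (x : ℕ) ∧ (x : ℕ) < top e M n₀ v base) ∨
      (∃ j, j < m ∧ (x : ℕ) = tpos j) := by
  obtain ⟨op, hop, hx'⟩ := exists_mem_wiresOf_of_mem_revCompile_toRevList _ _ hg hx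
  exact mem_wires_ops G hop hx'

end CleanXor

end Literature.Computability.QuantumComplexity

namespace Literature.Computability.Cryptography

namespace Regev2009

namespace SamplerClassical

open Literature.Computability.QuantumComplexity Literature.Computability.QuantumComplexity.RevSim

variable {W n : ℕ} {Λ : Layout W n} (hΛ : Λ.OK) (hF : Fits Λ)
include hΛ

/-- A wire whose index is the placement of a zone index is that zone wire. [folklore] -/
theorem eq_fin_of_val_eq_loc {x : Fin W} {i : ℕ} (hi : i < Λ.T) (hx : (x : ℕ) = Λ.loc i) : x = Λ.fin i :=
  Fin.ext (by rw [Layout.fin_val hΛ hi, hx])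

/-- **Wires of the compiled branch block**: zone wires or its work window. [cite: Regev2009, Lemma 3.14 (proof)] -/
theorem mem_wires_circY {g : QGate cliffordT W} (hg : g ∈ (circY hΛ hF).gates) {w : Fin W} (hw : w ∈ g.wires) :
    (∃ i, i < Λ.T ∧ w = Λ.fin i) ∨
      (Λ.base ≤ (w : ℕ) ∧ (w : ℕ) < CleanPlaced.top eY MY (n * Λ.ℓ + Λ.L) (vY Λ) Λ.base) := by
  have hT := Λ.T_eq
  have hoY : Λ.oY = n * Λ.ℓ + Λ.L := rfl
  rcases CleanXor.mem_wires_circuit (geomY hΛ hF) hg hw with ⟨i, hi, hx⟩ | h | ⟨j, hj, hx⟩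
  · exact Or.inl ⟨i, by omega, eq_fin_of_val_eq_loc hΛ (by omega) hx⟩
  · exact Or.inr h
  · exact Or.inl ⟨Λ.oY + j, by omega, eq_fin_of_val_eq_loc hΛ (by omega) hx⟩

/-- **Wires of the compiled residue block**: zone wires or its work window. [cite: Regev2009, Lemma 3.14 (proof)] -/
theorem mem_wires_circS {g : QGate cliffordT W} (hg : g ∈ (circS hΛ hF).gates) {w : Fin W} (hw : w ∈ g.wires) :
    (∃ i, i < Λ.T ∧ w = Λ.fin i) ∨
      (Λ.base ≤ (w : ℕ) ∧ (w : ℕ) < CleanPlaced.top eS MS (n * Λ.ℓ + Λ.L) (vS Λ) Λ.base) := by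
  have hT := Λ.T_eq
  have hoS : Λ.oS = n * Λ.ℓ + Λ.L + n * Λ.ℓY := rfl
  rcases CleanXor.mem_wires_circuit (geomS hΛ hF) hg hw with ⟨i, hi, hx⟩ | h | ⟨j, hj, hx⟩
  · exact Or.inl ⟨i, by omega, eq_fin_of_val_eq_loc hΛ (by omega) hx⟩
  · exact Or.inr h
  · exact Or.inl ⟨Λ.oS + j, by omega, eq_fin_of_val_eq_loc hΛ (by omega) hx⟩

/-- **Wires of the compiled erasing block**: zone wires or its work window. [cite: Regev2009, Lemma 3.14 (proof)] -/
theorem mem_wires_circX {g : QGate cliffordT W} (hg : g ∈ (circX hΛ hF).gates) {w : Fin W} (hw : w ∈ g.wires) :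
    (∃ i, i < Λ.T ∧ w = Λ.fin i) ∨
      (Λ.base ≤ (w : ℕ) ∧ (w : ℕ) < CleanPlaced.top eX MX (Λ.regLen + Λ.L) (vX Λ) Λ.base) := by
  have hT := Λ.T_eq
  have hoU : Λ.oU = n * Λ.ℓ := rfl
  have hoY : Λ.oY = n * Λ.ℓ + Λ.L := rfl
  have hreg : Λ.regLen = n * Λ.ℓY + n * Λ.ℓR + n * Λ.bc := rfl
  rcases CleanXor.mem_wires_circuit (geomX hΛ hF) hg hw with ⟨i, hi, hx⟩ | h | ⟨j, hj, hx⟩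
  · unfold dposX at hx
    by_cases hi' : i < Λ.regLen
    · rw [if_pos hi'] at hx
      exact Or.inl ⟨Λ.oY + i, by omega, eq_fin_of_val_eq_loc hΛ (by omega) hx⟩
    · rw [if_neg hi'] at hx
      exact Or.inl ⟨Λ.oU + (i - Λ.regLen), by omega, eq_fin_of_val_eq_loc hΛ (by omega) hx⟩
  · exact Or.inr h
  · exact Or.inl ⟨j, by omega, eq_fin_of_val_eq_loc hΛ (by omega) hx⟩

omit hΛ in
/-- Wires of the placed subroutine lie in its block. [folklore] -/
theorem mem_range_of_mem_mapWires {M : ℕ} (E : Fin M ↪ Fin W) (T : QCircuit cliffordT M) {g : QGate cliffordT W}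
    (hg : g ∈ (mapWires E T).gates) {w : Fin W} (hw : w ∈ g.wires) : w ∈ Set.range E := by
  obtain ⟨g', -, rfl⟩ := List.mem_map.1 hg
  exact wires_mapWiresGate_subset E g' w hw

/-- **Wires of the stage circuit**: the slot's zone wires, its work window (below any bound `B` on the three
window tops), or the wires of the placed subroutine. [cite: Regev2009, Lemma 3.14 (proof: the registers)]
[cite: NielsenChuang2010, §4.2] -/
theorem mem_wires_stageCirc {M : ℕ} (E : Fin M ↪ Fin W) (T : QCircuit cliffordT M) {B : ℕ}
    (hBY : CleanPlaced.top eY MY (n * Λ.ℓ + Λ.L) (vY Λ) Λ.base ≤ B)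
    (hBS : CleanPlaced.top eS MS (n * Λ.ℓ + Λ.L) (vS Λ) Λ.base ≤ B)
    (hBX : CleanPlaced.top eX MX (Λ.regLen + Λ.L) (vX Λ) Λ.base ≤ B)
    {g : QGate cliffordT W} (hg : g ∈ (stageCirc hΛ hF E T).gates) {w : Fin W} (hw : w ∈ g.wires) :
    (∃ i, i < Λ.T ∧ w = Λ.fin i) ∨ (Λ.base ≤ (w : ℕ) ∧ (w : ℕ) < B) ∨ w ∈ Set.range E := by
  simp only [stageCirc, QCircuit.append, List.mem_append] at hg
  rcases hg with (((hg | hg) | hg) | hg) | hg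
  · rcases mem_wires_circY hΛ hF hg hw with h | h
    · exact Or.inl h
    · exact Or.inr (Or.inl ⟨h.1, h.2.trans_le hBY⟩)
  · rcases mem_wires_circS hΛ hF hg hw with h | h
    · exact Or.inl h
    · exact Or.inr (Or.inl ⟨h.1, h.2.trans_le hBS⟩)
  · exact Or.inr (Or.inr (mem_range_of_mem_mapWires E T hg hw))
  · rcases mem_wires_circX hΛ hF hg hw with h | h
    · exact Or.inl h
    · exact Or.inr (Or.inl ⟨h.1, h.2.trans_le hBX⟩)
  · exact Or.inr (Or.inr (mem_range_of_mem_mapWires E T hg hw))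

/-- **The stage circuit of a slot acts inside the slot**: every gate's wires lie in any set containing the
zone wires, the work window below `B` and the subroutine block. [cite: Regev2009, Lemma 3.14 (proof: the registers)] -/
theorem wires_stageCirc_subset {M : ℕ} (E : Fin M ↪ Fin W) (T : QCircuit cliffordT M) {B : ℕ}
    (hBY : CleanPlaced.top eY MY (n * Λ.ℓ + Λ.L) (vY Λ) Λ.base ≤ B)
    (hBS : CleanPlaced.top eS MS (n * Λ.ℓ + Λ.L) (vS Λ) Λ.base ≤ B)
    (hBX : CleanPlaced.top eX MX (Λ.regLen + Λ.L) (vX Λ) Λ.base ≤ B) {S : Finset (Fin W)}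
    (hz : ∀ i, i < Λ.T → Λ.fin i ∈ S) (hwin : ∀ w : Fin W, Λ.base ≤ (w : ℕ) → (w : ℕ) < B → w ∈ S)
    (hE : ∀ i, E i ∈ S) : ∀ g ∈ (stageCirc hΛ hF E T).gates, g.wires ⊆ S := by
  intro g hg w hw
  rcases mem_wires_stageCirc hΛ hF E T hBY hBS hBX hg hw with ⟨i, hi, rfl⟩ | ⟨h1, h2⟩ | ⟨i, rfl⟩
  · exact hz i hi
  · exact hwin w h1 h2
  · exact hE i

end SamplerClassical

end Regev2009

end Literature.Computability.Cryptography

end
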